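import Summits.RiemannHypothesis.RiemannHypothesis.Theorems.EtaLeadingQuarterWeakLockingLayerGauss
import Summits.RiemannHypothesis.RiemannHypothesis.Theorems.EtaLeadingQuarterWeakLockingLayerZeroSide

/-!
# The weak locking layer, I: the layer and its algebra
(route EtaLeadingQuarter, item `WeakLockingLayer`, stmt-RiemannHypothesis-21792)

The explicit RH-free layer of BRIEF-L18 §1 with the parameters fixed once and for all:
width `s_M² = (log M)/150` (so that `s_M² γ² ≥ (196/150) log M > log M` at every zero, using the
tree's certified `|γ| > 14`), centre `n_M = (9/10) log M`, profile
`g_M(m) = exp(−(log m − n_M)²/(2 s_M²))`, mass `D_M = ∑_{m=2}^{M} g_M(m)`, locking constant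
`L_M = 1 − ∑_{m=2}^{M} (−1)^m m^{−1/2}` and the layer `e_M(m) = (L_M/D_M) g_M(m)`:

* exact locking `∑_{m=2}^{M} e_M(m) = L_M` (`M ≥ 2`), `0 ≤ L_M ≤ 1` (alternating series),
  energy `∑ e_M(m)² ≤ 1/D_M`;
* the Dirichlet polynomial of the statement is `(L_M/D_M) · D_c(−γ)` for the coefficient vector
  `c = g_M · 1_{m ≥ 2}` of `EtaLeadingQuarterWeakLockingLayerZeroSide.lean`, and the zero-side
  functional factors as `A_M² · ∑'_ρ m γ^{-2} ‖D_c(γ)‖²`.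

Part II assembles the estimates. Nothing here bears on the truth of RH.
-/

noncomputable section

open Complex MeasureTheory Set Filter Finset intervalIntegral
open scoped Real Topology ComplexConjugate

set_option linter.dupNamespace false  -- the mandated namespace repeats `RiemannHypothesis`

namespace Summit.RiemannHypothesis.RiemannHypothesis.Theorems.EtaLeadingQuarter.Locking

open Literature.NumberTheory.LFunctions NicolasJExplicit SchoenfeldBound ZetaZeroTails
open Summit.RiemannHypothesis.RiemannHypothesis.Theorems.EtaLeadingQuarter.LockingEngine
open Summit.RiemannHypothesis.RiemannHypothesis.Theorems.EtaLeadingQuarter.ZeroSide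

/-! ## The layer -/

/-- The log-scale width `s_M = √((log M)/150)`. [folklore] -/
def width (M : ℕ) : ℝ := Real.sqrt (Real.log M / 150)

/-- The log-scale centre `n_M = (9/10) log M`. [folklore] -/
def center (M : ℕ) : ℝ := 9 / 10 * Real.log M

/-- The Gaussian profile `g_M(m) = exp(−(log m − n_M)²/(2 s_M²))`. [folklore] -/
def bump (M m : ℕ) : ℝ := Real.exp (-((Real.log m - center M) ^ 2 / (2 * width M ^ 2)))

/-- The mass `D_M = ∑_{m=2}^{M} g_M(m)`. [folklore] -/
def mass (M : ℕ) : ℝ := ∑ m ∈ Finset.Icc 2 M, bump M m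

/-- The locking constant `L_M = 1 − ∑_{m=2}^{M} (−1)^m m^{−1/2}` (verbatim from the route decl).
[folklore] -/
def lockConst (M : ℕ) : ℝ := 1 - ∑ m ∈ Finset.Icc 2 M, (-1 : ℝ) ^ m * (m : ℝ) ^ (-(1 / 2 : ℝ))

/-- The amplitude `A_M = L_M / D_M`. [folklore] -/
def amp (M : ℕ) : ℝ := lockConst M / mass M

/-- The layer `e_M(m) = A_M g_M(m)`. [folklore] -/
def layer (M m : ℕ) : ℝ := amp M * bump M m

/-- The coefficient vector `c_M = g_M · 1_{m ≥ 2}` fed to `ZeroSide.dirPoly`. [folklore] -/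
def coeff (M k : ℕ) : ℝ := if 2 ≤ k then bump M k else 0

/-! ## Elementary algebra of the layer -/

/-- `0 < g_M(m)`. [folklore] -/
theorem bump_pos (M m : ℕ) : 0 < bump M m := Real.exp_pos _

/-- `g_M(m) ≤ 1`. [folklore] -/
theorem bump_le_one (M m : ℕ) : bump M m ≤ 1 := by
  unfold bump
  rw [Real.exp_le_one_iff, neg_nonpos]
  positivity

/-- `0 < D_M` for `M ≥ 2`. [folklore] -/
theorem mass_pos {M : ℕ} (hM : 2 ≤ M) : 0 < mass M :=
  Finset.sum_pos (fun m _ ↦ bump_pos M m) ⟨2, Finset.mem_Icc.2 ⟨le_rfl, hM⟩⟩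

/-- `0 ≤ D_M`. [folklore] -/
theorem mass_nonneg (M : ℕ) : 0 ≤ mass M := Finset.sum_nonneg fun m _ ↦ (bump_pos M m).le

/-- **Exact locking**: `∑_{m=2}^{M} e_M(m) = L_M` for `M ≥ 2`. [folklore] -/
theorem sum_layer {M : ℕ} (hM : 2 ≤ M) :
    ∑ m ∈ Finset.Icc 2 M, layer M m = lockConst M := by
  unfold layer amp
  rw [← Finset.mul_sum, ← mass, div_mul_cancel₀ _ (mass_pos hM).ne']

/-- `∑ c_M(k)² ≤ D_M` over `1 ≤ k ≤ M` (`g² ≤ g`). [folklore] -/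
theorem sum_coeff_sq_le (M : ℕ) : ∑ k ∈ Finset.Icc 1 M, coeff M k ^ 2 ≤ mass M := by
  have h : ∀ k ∈ Finset.Icc 1 M, coeff M k ^ 2 ≤ if 2 ≤ k then bump M k else 0 := by
    intro k _
    unfold coeff
    split_ifs with hk
    · have h0 := (bump_pos M k).le
      have h1 := bump_le_one M k
      nlinarith
    · simp
  refine (Finset.sum_le_sum h).trans ?_
  rw [← Finset.sum_filter]
  have hs : (Finset.Icc 1 M).filter (fun k ↦ 2 ≤ k) = Finset.Icc 2 M := by
    ext k; simp only [Finset.mem_filter, Finset.mem_Icc]; omega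
  rw [hs, mass]

/-- `∑ |c_M(k)| = D_M`. [folklore] -/
theorem sum_abs_coeff (M : ℕ) : ∑ k ∈ Finset.Icc 1 M, |coeff M k| = mass M := by
  have h : ∀ k ∈ Finset.Icc 1 M, |coeff M k| = if 2 ≤ k then bump M k else 0 := by
    intro k _
    unfold coeff
    split_ifs
    · exact abs_of_pos (bump_pos M k)
    · simp
  rw [Finset.sum_congr rfl h, ← Finset.sum_filter]
  have hs : (Finset.Icc 1 M).filter (fun k ↦ 2 ≤ k) = Finset.Icc 2 M := by
    ext k; simp only [Finset.mem_filter, Finset.mem_Icc]; omega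
  rw [hs, mass]

/-- Energy: `∑_{m=2}^{M} e_M(m)² = A_M² ∑ g² ≤ L_M² / D_M` (`M ≥ 2`). [folklore] -/
theorem sum_layer_sq_le {M : ℕ} (hM : 2 ≤ M) :
    ∑ m ∈ Finset.Icc 2 M, layer M m ^ 2 ≤ lockConst M ^ 2 / mass M := by
  have hD := mass_pos hM
  have h1 : ∑ m ∈ Finset.Icc 2 M, layer M m ^ 2 = amp M ^ 2 * ∑ m ∈ Finset.Icc 2 M, bump M m ^ 2 := by
    rw [Finset.mul_sum]
    refine Finset.sum_congr rfl fun m _ ↦ ?_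
    unfold layer; ring
  have h2 : ∑ m ∈ Finset.Icc 2 M, bump M m ^ 2 ≤ mass M :=
    Finset.sum_le_sum fun m _ ↦ by
      have h0 := (bump_pos M m).le
      have h1 := bump_le_one M m
      nlinarith
  rw [h1]
  calc amp M ^ 2 * ∑ m ∈ Finset.Icc 2 M, bump M m ^ 2 ≤ amp M ^ 2 * mass M :=
        mul_le_mul_of_nonneg_left h2 (sq_nonneg _)
    _ = lockConst M ^ 2 / mass M := by
        unfold amp
        field_simp

/-! ## The alternating series bound `0 ≤ L_M ≤ 1` -/

/-- The partial sums `S_M = ∑_{m=1}^{M} (−1)^{m+1} m^{−1/2}` satisfy, with `u_m = m^{−1/2}`,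
`0 ≤ S_M − [M odd] u_{M+1}` and `S_M + [M even] u_{M+1} ≤ 1` (Leibniz). [folklore] -/
theorem altSum_bounds : ∀ M : ℕ, 1 ≤ M →
    (0 ≤ ∑ m ∈ Finset.Icc 1 M, (-1 : ℝ) ^ (m + 1) * (m : ℝ) ^ (-(1 / 2 : ℝ)) -
        (if Even M then 0 else ((M + 1 : ℕ) : ℝ) ^ (-(1 / 2 : ℝ))) ∧
      ∑ m ∈ Finset.Icc 1 M, (-1 : ℝ) ^ (m + 1) * (m : ℝ) ^ (-(1 / 2 : ℝ)) +
        (if Even M then ((M + 1 : ℕ) : ℝ) ^ (-(1 / 2 : ℝ)) else 0) ≤ 1) := by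
  -- `u` is antitone and nonnegative
  have hu_anti : ∀ a b : ℕ, 1 ≤ a → a ≤ b → (b : ℝ) ^ (-(1 / 2 : ℝ)) ≤ (a : ℝ) ^ (-(1 / 2 : ℝ)) := by
    intro a b ha hab
    exact Real.rpow_le_rpow_of_nonpos (by exact_mod_cast ha) (by exact_mod_cast hab) (by norm_num)
  have hu_nn : ∀ a : ℕ, 0 ≤ (a : ℝ) ^ (-(1 / 2 : ℝ)) := fun a ↦ Real.rpow_nonneg (Nat.cast_nonneg a) _
  intro M hM
  induction M with
  | zero => omega
  | succ M ih =>
    rcases Nat.lt_or_ge M 1 with h0 | h1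
    · interval_cases M
      norm_num
      have := hu_anti 1 2 le_rfl (by norm_num)
      simp only [Nat.cast_one, Real.one_rpow, Nat.cast_ofNat] at this
      exact this
    obtain ⟨ihl, ihu⟩ := ih h1
    rw [Finset.sum_Icc_succ_top (by omega)]
    have hu12 := hu_anti (M + 1) (M + 1 + 1) (by omega) (by omega)
    have hu0 := hu_nn (M + 1 + 1)
    rcases Nat.even_or_odd M with hE | hO
    · -- `M` even, `M + 1` odd
      have hE' : ¬ Even (M + 1) := by rw [Nat.even_add_one]; exact not_not.2 hE
      have hpow : (-1 : ℝ) ^ (M + 1 + 1) = 1 := by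
        rw [Even.neg_one_pow]; exact (Nat.even_add_one.2 hE')
      rw [if_pos hE, if_pos hE] at *
      rw [if_neg hE', if_neg hE', hpow, one_mul]
      push_cast at *
      constructor <;> linarith
    · -- `M` odd, `M + 1` even
      have hO' : ¬ Even M := Nat.not_even_iff_odd.2 hO
      have hE1 : Even (M + 1) := hO.add_one
      have hpow : (-1 : ℝ) ^ (M + 1 + 1) = -1 := by
        rw [Odd.neg_one_pow]; exact hE1.add_one
      rw [if_neg hO', if_neg hO'] at *
      rw [if_pos hE1, if_pos hE1, hpow, neg_one_mul]
      push_cast at *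
      constructor <;> linarith

/-- `L_M = ∑_{m=1}^{M} (−1)^{m+1} m^{−1/2}` for `M ≥ 1`. [folklore] -/
theorem lockConst_eq {M : ℕ} (hM : 1 ≤ M) :
    lockConst M = ∑ m ∈ Finset.Icc 1 M, (-1 : ℝ) ^ (m + 1) * (m : ℝ) ^ (-(1 / 2 : ℝ)) := by
  unfold lockConst
  rw [← Finset.insert_Icc_add_one_left_eq_Icc hM, Finset.sum_insert (by simp)]
  simp only [Nat.cast_one, Real.one_rpow, pow_succ, mul_neg, mul_one, neg_mul, neg_neg,
    Finset.sum_neg_distrib]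
  norm_num
  ring

/-- **`0 ≤ L_M ≤ 1`.** [folklore] -/
theorem lockConst_mem (M : ℕ) : 0 ≤ lockConst M ∧ lockConst M ≤ 1 := by
  rcases Nat.lt_or_ge M 1 with h0 | h1
  · interval_cases M
    simp [lockConst]
  have hu_nn : ∀ a : ℕ, 0 ≤ (a : ℝ) ^ (-(1 / 2 : ℝ)) := fun a ↦ Real.rpow_nonneg (Nat.cast_nonneg a) _
  obtain ⟨hl, hu⟩ := altSum_bounds M h1
  rw [lockConst_eq h1]
  have := hu_nn (M + 1)
  constructor
  · split_ifs at hl <;> linarith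
  · split_ifs at hu <;> linarith

/-- `|L_M| ≤ 1`, hence `A_M² ≤ 1/D_M²` and `∑ e² ≤ 1/D_M`. [folklore] -/
theorem abs_lockConst_le (M : ℕ) : |lockConst M| ≤ 1 := by
  obtain ⟨h0, h1⟩ := lockConst_mem M
  rw [abs_of_nonneg h0]; exact h1

/-! ## The Dirichlet polynomial of the statement -/

/-- `∑_{m=2}^{M} g_M(m) m^{iγ} = D_c(−γ)` with `c = coeff M`. [folklore] -/
theorem sum_bump_cpow_eq (M : ℕ) (γ : ℝ) :
    ∑ m ∈ Finset.Icc 2 M, ((bump M m : ℝ) : ℂ) * (m : ℂ) ^ (((γ : ℝ) : ℂ) * I) =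
      dirPoly (coeff M) M (-γ) := by
  unfold dirPoly
  rcases Nat.lt_or_ge M 1 with h0 | h1
  · interval_cases M
    simp
  rw [← Finset.insert_Icc_add_one_left_eq_Icc h1, Finset.sum_insert (by simp)]
  have h1' : ((coeff M 1 : ℝ) : ℂ) = 0 := by simp [coeff]
  rw [h1', zero_mul, zero_add]
  refine Finset.sum_congr rfl fun m hm ↦ ?_
  rw [Finset.mem_Icc] at hm
  have hm2 : 2 ≤ m := by omega
  have hc : coeff M m = bump M m := by simp [coeff, hm2]
  rw [hc]
  congr 1
  push_cast
  ring_nf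

/-- The statement's Dirichlet polynomial: `‖∑_{m=2}^{M} e_M(m) m^{iγ}‖ = |A_M| · ‖D_c(γ)‖`. [folklore] -/
theorem norm_sum_layer_cpow (M : ℕ) (γ : ℝ) :
    ‖∑ m ∈ Finset.Icc 2 M, ((layer M m : ℝ) : ℂ) * (m : ℂ) ^ (((γ : ℝ) : ℂ) * I)‖ =
      |amp M| * ‖dirPoly (coeff M) M γ‖ := by
  have h : ∑ m ∈ Finset.Icc 2 M, ((layer M m : ℝ) : ℂ) * (m : ℂ) ^ (((γ : ℝ) : ℂ) * I) =
      ((amp M : ℝ) : ℂ) * ∑ m ∈ Finset.Icc 2 M, ((bump M m : ℝ) : ℂ) * (m : ℂ) ^ (((γ : ℝ) : ℂ) * I) := by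
    rw [Finset.mul_sum]
    refine Finset.sum_congr rfl fun m _ ↦ ?_
    unfold layer; push_cast; ring
  rw [h, norm_mul, Complex.norm_real, Real.norm_eq_abs, sum_bump_cpow_eq, norm_dirPoly_neg]

/-- The zero-side functional of the statement, over the tree's index type `Zeros`, factors as
`A_M² · ∑'_ρ m γ^{-2} ‖D_c(γ)‖²`. [folklore] -/
theorem tsum_layer_eq (M : ℕ) :
    ∑' ρ : ZetaZeros.riemannZetaNontrivialZeros,
        (riemannZetaZeroOrder (ρ : ℂ) : ℝ) / (ρ : ℂ).im ^ 2 *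
          ‖∑ m ∈ Finset.Icc 2 M, ((layer M m : ℝ) : ℂ) * (m : ℂ) ^ ((((ρ : ℂ).im : ℝ) : ℂ) * I)‖ ^ 2 =
      amp M ^ 2 * ∑' ρ : Zeros,
        (riemannZetaZeroOrder (ρ : ℂ) : ℝ) / (ρ : ℂ).im ^ 2 * ‖dirPoly (coeff M) M (ρ : ℂ).im‖ ^ 2 := by
  rw [← tsum_mul_left]
  exact tsum_congr fun ρ ↦ by rw [norm_sum_layer_cpow, mul_pow, sq_abs]; ring

end Summit.RiemannHypothesis.RiemannHypothesis.Theorems.EtaLeadingQuarter.Locking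

end
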